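import Mathlib
import HarnessLib

/-!
# `WakeRatchet.TailRatchet` (stmt-NavierStokesRegularity-21808), door D4′ — the TYPE-I BLOW-UP RATE of
# the non-negative dyadic chain, part 1: the Riccati functional (instant inequalities and comparison)

Def-free support lemmas for the aside crux `TailRatchet` (route `WakeRatchet`).  MODEL lattice ODEs only
(the scalar dyadic / Katz–Pavlović / Cheskidov chain of Tao 2016 §1.2, §4 — the `m = 1` member
`Ẋₙ = Λⁿ⁻¹ Xₙ₋₁² − Λⁿ Xₙ Xₙ₊₁`, `Λ = (1+ε₀)^{5/2}`); nothing in this file is a statement about the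
Navier–Stokes equations, and stmt-21808 is neither proved nor refuted here.

WHY.  The census of the item (hands g11–g13, files `WakeRatchetTailRatchetStall`, `…StallLimit`,
`…FiringClock`) reduces the refutation of `TailRatchet` ("door D4′") to a-priori estimates for the
non-negative dyadic CAUCHY blow-up: a uniform (type-I) bound, a per-shell action bound, post-firing decay
and firing-gap bounds, and the extraction.  The first of these — the uniform bound of the recentred
frames, i.e. the scale-critical rate `Λⁿ Xₙ(t) ≤ D/(T* − t)` — is proved in this file and its
companion `WakeRatchetTailRatchetDyadicTypeIRate`, for EVERY `Λ > 1`, with the explicit constant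
`D = 2Λ²/(Λ−1)²`, by a short monotonicity argument (Katz–Pavlović 2005, Kiselev–Zlatoš 2005,
Cheskidov 2008 prove blow-up through weighted `H^s`-type functionals; the point is that the UNWEIGHTED
amplitude sum above an ARBITRARY shell is already such a functional, and re-anchoring it at the shell
in question gives the scale-invariant rate; the census of the item records the rate as not in print).

THE ARGUMENT.  Fix a shell `N` and put `Zⱼ = Λᴺ X_{N+j}` (`j ≥ 0`), so that
`Żⱼ₊₁ = Λʲ Zⱼ² − Λʲ⁺¹ Zⱼ₊₁ Zⱼ₊₂` and `Ż₀ ≥ −Z₀Z₁` (the feed `Λᴺ⁻¹X²_{N−1} ≥ 0` from below is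
DROPPED — nothing below shell `N` is used).  For `P = Σⱼ Zⱼ` and `S = Σⱼ Λʲ Zⱼ²`:
`Ṗ ≥ S − Σⱼ Λʲ ZⱼZⱼ₊₁ ≥ S − ½S − ½Λ⁻¹S = (Λ−1)/(2Λ)·S` (AM–GM on the drains), and
`S ≥ (Λ−1)/Λ · P²` (Cauchy–Schwarz against `Σ Λ⁻ʲ = Λ/(Λ−1)`), so `Ṗ ≥ k P²` with
`k = (Λ−1)²/(2Λ²)`; hence `P`, which is dominated by `sup_{n ≥ N} ΛⁿXₙ · Λ/(Λ−1)`, leaves every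
bounded set within time `1/(k P(t₀)) ≤ 1/(k Λᴺ X_N(t₀))`.

CONTENTS of this part (all def-free): summability under a geometric envelope `|zⱼ| ≤ BΛ⁻ʲ`
(`summable_of_envelope`, `summable_sq_of_envelope`, `summable_drain_of_envelope`, …); the two
sequence inequalities at one instant, `drive_lower_bound` (`Σ dⱼ ≥ (Λ−1)/(2Λ)·Σ Λʲzⱼ²`) and
`coercive_lower_bound` (`(Λ−1)/Λ·(Σ|zⱼ|)² ≤ Σ Λʲ zⱼ²`), combined in `sq_growth_at_instant`
(`(Λ−1)²/(2Λ²)·(Σ zⱼ)² ≤ Σ dⱼ`); and the comparison lemma `time_le_of_sq_growth`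
(`f' ≥ k f², f(t₀) > 0 ⇒ (T − t₀)·f(t₀) ≤ k⁻¹`).  The blow-up time bound and the ℤ-indexed type-I
corollary are in the companion file.

HONEST FRAMING: elementary real analysis; the remaining Cauchy-side inputs of door D4′ (per-shell
action, post-firing decay, extraction) are NOT addressed; no stub of skeleton d00b85951d7c is closed;
rung 0.
-/

noncomputable section

set_option linter.dupNamespace false

namespace Summit.NavierStokesRegularity.NavierStokesRegularity.Theorems

namespace WakeRatchetDyadicTypeI

open Set Filter Topology

/-! ## Summability under a geometric envelope -/

section Envelope

variable {Λ B : ℝ} {z : ℕ → ℝ}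

/-- `Σ Λ⁻ʲ` converges for `Λ > 1`. [folklore] -/
theorem summable_inv_pow (hΛ : 1 < Λ) : Summable fun j : ℕ => Λ⁻¹ ^ j :=
  summable_geometric_of_lt_one (inv_nonneg.2 (by linarith)) (inv_lt_one_of_one_lt₀ hΛ)

/-- `Σ Λ⁻ʲ = Λ/(Λ−1)` for `Λ > 1`. [folklore] -/
theorem tsum_inv_pow (hΛ : 1 < Λ) : ∑' j : ℕ, Λ⁻¹ ^ j = Λ / (Λ - 1) := by
  rw [tsum_geometric_of_lt_one (inv_nonneg.2 (by linarith)) (inv_lt_one_of_one_lt₀ hΛ)]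
  have hΛ0 : Λ ≠ 0 := by positivity
  have hΛ1 : Λ - 1 ≠ 0 := by linarith
  field_simp

/-- `Λʲ · Λ⁻ʲ = 1`. [folklore] -/
theorem pow_mul_inv_pow (hΛ : 1 < Λ) (j : ℕ) : Λ ^ j * Λ⁻¹ ^ j = 1 := by
  rw [← mul_pow, mul_inv_cancel₀ (by positivity), one_pow]

/-- A geometrically enveloped sequence is summable. [folklore] -/
theorem summable_of_envelope (hΛ : 1 < Λ) (hz : ∀ j, |z j| ≤ B * Λ⁻¹ ^ j) : Summable z :=
  Summable.of_norm_bounded ((summable_inv_pow hΛ).mul_left B) fun j => by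
    rw [Real.norm_eq_abs]; exact hz j

/-- … and so is its absolute value. [folklore] -/
theorem summable_abs_of_envelope (hΛ : 1 < Λ) (hz : ∀ j, |z j| ≤ B * Λ⁻¹ ^ j) :
    Summable fun j => |z j| :=
  Summable.of_norm_bounded ((summable_inv_pow hΛ).mul_left B) fun j => by
    rw [Real.norm_eq_abs, abs_abs]; exact hz j

/-- The weighted squares `Λʲ zⱼ²` of a geometrically enveloped sequence are summable
(`Λʲ zⱼ² ≤ B² Λ⁻ʲ`). [folklore] -/
theorem summable_sq_of_envelope (hΛ : 1 < Λ) (hz : ∀ j, |z j| ≤ B * Λ⁻¹ ^ j) :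
    Summable fun j => Λ ^ j * z j ^ 2 := by
  refine Summable.of_norm_bounded ((summable_inv_pow hΛ).mul_left (B ^ 2)) fun j => ?_
  have hΛj : 0 ≤ Λ ^ j := by positivity
  have hq : 0 ≤ Λ⁻¹ ^ j := by positivity
  rw [Real.norm_eq_abs, abs_of_nonneg (by positivity)]
  have h1 : z j ^ 2 ≤ (B * Λ⁻¹ ^ j) ^ 2 := by
    calc z j ^ 2 = |z j| ^ 2 := (sq_abs _).symm
      _ ≤ (B * Λ⁻¹ ^ j) ^ 2 := pow_le_pow_left₀ (abs_nonneg _) (hz j) 2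
  calc Λ ^ j * z j ^ 2 ≤ Λ ^ j * (B * Λ⁻¹ ^ j) ^ 2 := mul_le_mul_of_nonneg_left h1 hΛj
    _ = B ^ 2 * Λ⁻¹ ^ j * (Λ ^ j * Λ⁻¹ ^ j) := by ring
    _ = B ^ 2 * Λ⁻¹ ^ j := by rw [pow_mul_inv_pow hΛ, mul_one]

/-- The shifted weighted squares `Λʲ zⱼ₊₁²` are summable. [folklore] -/
theorem summable_sq_succ_of_envelope (hΛ : 1 < Λ) (hz : ∀ j, |z j| ≤ B * Λ⁻¹ ^ j) :
    Summable fun j => Λ ^ j * z (j + 1) ^ 2 := by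
  have h := (summable_nat_add_iff 1).2 (summable_sq_of_envelope hΛ hz)
  have h' : Summable fun j => Λ⁻¹ * (Λ ^ (j + 1) * z (j + 1) ^ 2) := h.mul_left Λ⁻¹
  refine h'.congr fun j => ?_
  have hΛ0 : Λ ≠ 0 := by positivity
  rw [pow_succ]
  field_simp

/-- The weighted drains `Λʲ zⱼ zⱼ₊₁` are summable. [folklore] -/
theorem summable_drain_of_envelope (hΛ : 1 < Λ) (hz : ∀ j, |z j| ≤ B * Λ⁻¹ ^ j) :
    Summable fun j => Λ ^ j * (z j * z (j + 1)) := by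
  refine Summable.of_norm_bounded
    (((summable_sq_of_envelope hΛ hz).add (summable_sq_succ_of_envelope hΛ hz)).mul_left (1 / 2))
    fun j => ?_
  have hΛj : 0 ≤ Λ ^ j := by positivity
  rw [Real.norm_eq_abs, abs_mul, abs_of_nonneg hΛj, abs_mul]
  have h : |z j| * |z (j + 1)| ≤ (z j ^ 2 + z (j + 1) ^ 2) / 2 := by
    nlinarith [sq_nonneg (|z j| - |z (j + 1)|), sq_abs (z j), sq_abs (z (j + 1))]
  calc Λ ^ j * (|z j| * |z (j + 1)|) ≤ Λ ^ j * ((z j ^ 2 + z (j + 1) ^ 2) / 2) :=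
        mul_le_mul_of_nonneg_left h hΛj
    _ = 1 / 2 * (Λ ^ j * z j ^ 2 + Λ ^ j * z (j + 1) ^ 2) := by ring

end Envelope

/-! ## The two sequence inequalities at one instant -/

section Instant

variable {Λ B : ℝ} {z d : ℕ → ℝ}

/-- **Drive.**  If `d₀ ≥ −z₀z₁` and `dⱼ₊₁ ≥ Λʲ zⱼ² − Λʲ⁺¹ zⱼ₊₁ zⱼ₊₂` (the dyadic law above the anchor
shell, feed into the anchor dropped), then `Σ dⱼ ≥ (Λ−1)/(2Λ) · Σ Λʲ zⱼ²`.
[cite: Tao2016AveragedNS, §1.2 (the dyadic model `∂ₜXₙ = λⁿ⁻¹Xₙ₋₁² − λⁿXₙXₙ₊₁`) and §4 (4.8); elementary (AM–GM on the drains)] -/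
theorem drive_lower_bound (hΛ : 1 < Λ) (hz : ∀ j, |z j| ≤ B * Λ⁻¹ ^ j) (hd : Summable d)
    (h0 : -(z 0 * z 1) ≤ d 0)
    (hS : ∀ j, Λ ^ j * z j ^ 2 - Λ ^ (j + 1) * z (j + 1) * z (j + 2) ≤ d (j + 1)) :
    (Λ - 1) / (2 * Λ) * ∑' j, Λ ^ j * z j ^ 2 ≤ ∑' j, d j := by
  have hΛ0 : 0 < Λ := by linarith
  -- names for the summable pieces
  have hSq := summable_sq_of_envelope hΛ hz
  have hSq1 := summable_sq_succ_of_envelope hΛ hz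
  have hDr := summable_drain_of_envelope hΛ hz
  have hDr1 : Summable fun j => Λ ^ (j + 1) * (z (j + 1) * z (j + 2)) :=
    (summable_nat_add_iff 1).2 hDr
  have hd1 : Summable fun j => d (j + 1) := (summable_nat_add_iff 1).2 hd
  set S : ℝ := ∑' j, Λ ^ j * z j ^ 2 with hSdef
  -- (1) split off the anchor shell
  rw [hd.tsum_eq_zero_add]
  -- (2) the law above the anchor, summed
  have h2 : ∑' j, (Λ ^ j * z j ^ 2 - Λ ^ (j + 1) * (z (j + 1) * z (j + 2))) ≤ ∑' j, d (j + 1) :=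
    (hSq.sub hDr1).tsum_le_tsum (fun j => by have := hS j; linarith [this]) hd1
  rw [hSq.tsum_sub hDr1] at h2
  -- (3) recombine the drains: `z₀z₁ + Σ Λ^{j+1} z_{j+1} z_{j+2} = Σ Λ^j z_j z_{j+1}`
  have h3 : ∑' j, Λ ^ j * (z j * z (j + 1)) = z 0 * z 1 + ∑' j, Λ ^ (j + 1) * (z (j + 1) * z (j + 2)) := by
    rw [hDr.tsum_eq_zero_add]; simp
  -- (4) AM–GM on the drains
  have h4 : ∑' j, Λ ^ j * (z j * z (j + 1)) ≤ (1 / 2) * S + (1 / 2) * ∑' j, Λ ^ j * z (j + 1) ^ 2 := by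
    have hpt : ∀ j, Λ ^ j * (z j * z (j + 1)) ≤ (1 / 2) * (Λ ^ j * z j ^ 2) + (1 / 2) * (Λ ^ j * z (j + 1) ^ 2) := by
      intro j
      have hΛj : 0 ≤ Λ ^ j := by positivity
      have : z j * z (j + 1) ≤ (z j ^ 2 + z (j + 1) ^ 2) / 2 := by
        nlinarith [sq_nonneg (z j - z (j + 1))]
      calc Λ ^ j * (z j * z (j + 1)) ≤ Λ ^ j * ((z j ^ 2 + z (j + 1) ^ 2) / 2) :=
            mul_le_mul_of_nonneg_left this hΛj
        _ = _ := by ring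
    calc ∑' j, Λ ^ j * (z j * z (j + 1))
        ≤ ∑' j, ((1 / 2) * (Λ ^ j * z j ^ 2) + (1 / 2) * (Λ ^ j * z (j + 1) ^ 2)) :=
          hDr.tsum_le_tsum hpt ((hSq.mul_left _).add (hSq1.mul_left _))
      _ = (1 / 2) * S + (1 / 2) * ∑' j, Λ ^ j * z (j + 1) ^ 2 := by
          rw [(hSq.mul_left _).tsum_add (hSq1.mul_left _), tsum_mul_left, tsum_mul_left]
  -- (5) the shifted squares: `Σ Λ^j z_{j+1}² = Λ⁻¹ (S − z₀²) ≤ Λ⁻¹ S`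
  have h5 : ∑' j, Λ ^ j * z (j + 1) ^ 2 ≤ Λ⁻¹ * S := by
    have hsplit : S = Λ ^ 0 * z 0 ^ 2 + ∑' j, Λ ^ (j + 1) * z (j + 1) ^ 2 := by
      rw [hSdef, hSq.tsum_eq_zero_add]
    have hshift : ∑' j, Λ ^ (j + 1) * z (j + 1) ^ 2 = Λ * ∑' j, Λ ^ j * z (j + 1) ^ 2 := by
      rw [← tsum_mul_left]; congr 1; funext j; rw [pow_succ]; ring
    have hz0 : 0 ≤ z 0 ^ 2 := sq_nonneg _
    rw [pow_zero, one_mul, hshift] at hsplit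
    have : Λ * ∑' j, Λ ^ j * z (j + 1) ^ 2 ≤ S := by linarith
    calc ∑' j, Λ ^ j * z (j + 1) ^ 2 = Λ⁻¹ * (Λ * ∑' j, Λ ^ j * z (j + 1) ^ 2) := by
          field_simp
      _ ≤ Λ⁻¹ * S := mul_le_mul_of_nonneg_left this (inv_nonneg.2 hΛ0.le)
  -- (6) assemble
  have hS0 : 0 ≤ S := tsum_nonneg fun j => by positivity
  have hkey : (Λ - 1) / (2 * Λ) * S = S - (1 / 2) * S - (1 / 2) * (Λ⁻¹ * S) := by
    field_simp; ring
  rw [hkey]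
  linarith [h2, h3, h4, h5]

/-- **Coercivity.**  `(Λ−1)/Λ · (Σ|zⱼ|)² ≤ Σ Λʲ zⱼ²` (Cauchy–Schwarz against `Σ Λ⁻ʲ = Λ/(Λ−1)`,
done through the pointwise AM–GM `2|zⱼ| ≤ αΛ⁻ʲ + Λʲzⱼ²/α`). [folklore] -/
theorem coercive_lower_bound (hΛ : 1 < Λ) (hz : ∀ j, |z j| ≤ B * Λ⁻¹ ^ j) :
    (Λ - 1) / Λ * (∑' j, |z j|) ^ 2 ≤ ∑' j, Λ ^ j * z j ^ 2 := by
  have hΛ0 : 0 < Λ := by linarith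
  have hΛ1 : 0 < Λ - 1 := by linarith
  have hSq := summable_sq_of_envelope hΛ hz
  have hAbs := summable_abs_of_envelope hΛ hz
  set S : ℝ := ∑' j, Λ ^ j * z j ^ 2 with hSdef
  set Q : ℝ := ∑' j, |z j| with hQdef
  have hS0 : 0 ≤ S := tsum_nonneg fun j => by positivity
  have hQ0 : 0 ≤ Q := tsum_nonneg fun j => abs_nonneg _
  rcases hQ0.eq_or_lt with hQ | hQ
  · rw [← hQ]; simpa using hS0
  -- `α = Q (Λ−1)/Λ > 0`
  set α : ℝ := Q * ((Λ - 1) / Λ) with hαdef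
  have hα : 0 < α := by positivity
  have hpt : ∀ j, 2 * |z j| ≤ α * Λ⁻¹ ^ j + α⁻¹ * (Λ ^ j * z j ^ 2) := by
    intro j
    have hu : 0 < α * Λ⁻¹ ^ j := by positivity
    -- `2u|z| ≤ u² + z²` with `u = α Λ⁻ʲ`, divided by `u`; `z²/u = Λʲ z²/α`
    have h1 : 2 * (α * Λ⁻¹ ^ j) * |z j| ≤ (α * Λ⁻¹ ^ j) ^ 2 + z j ^ 2 := by
      nlinarith [sq_nonneg (α * Λ⁻¹ ^ j - |z j|), sq_abs (z j)]
    have h2 : z j ^ 2 = (α * Λ⁻¹ ^ j) * (α⁻¹ * (Λ ^ j * z j ^ 2)) := by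
      rw [show (α * Λ⁻¹ ^ j) * (α⁻¹ * (Λ ^ j * z j ^ 2))
          = (α * α⁻¹) * (Λ ^ j * Λ⁻¹ ^ j) * z j ^ 2 by ring,
        mul_inv_cancel₀ hα.ne', pow_mul_inv_pow hΛ, one_mul, one_mul]
    rw [h2] at h1
    have h3 : 2 * (α * Λ⁻¹ ^ j) * |z j| ≤ (α * Λ⁻¹ ^ j) * (α * Λ⁻¹ ^ j + α⁻¹ * (Λ ^ j * z j ^ 2)) := by
      nlinarith [h1]
    have h4 : 2 * |z j| * (α * Λ⁻¹ ^ j) ≤ (α * Λ⁻¹ ^ j + α⁻¹ * (Λ ^ j * z j ^ 2)) * (α * Λ⁻¹ ^ j) := by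
      nlinarith [h3]
    exact le_of_mul_le_mul_right h4 hu
  have hsum : 2 * Q ≤ α * (Λ / (Λ - 1)) + α⁻¹ * S := by
    have h := hAbs.tsum_le_tsum (fun j => by have := hpt j; linarith : ∀ j, |z j| ≤
        (1 / 2) * (α * Λ⁻¹ ^ j) + (1 / 2) * (α⁻¹ * (Λ ^ j * z j ^ 2)))
      ((((summable_inv_pow hΛ).mul_left α).mul_left _).add ((hSq.mul_left _).mul_left _))
    rw [(((summable_inv_pow hΛ).mul_left α).mul_left _).tsum_add ((hSq.mul_left _).mul_left _),
      tsum_mul_left, tsum_mul_left, tsum_mul_left, tsum_mul_left, tsum_inv_pow hΛ] at h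
    rw [hQdef, hSdef]
    linarith
  have hαΛ : α * (Λ / (Λ - 1)) = Q := by
    rw [hαdef]; field_simp
  rw [hαΛ] at hsum
  have hQS : Q ≤ α⁻¹ * S := by linarith
  have : Q * α ≤ S := by
    calc Q * α ≤ (α⁻¹ * S) * α := mul_le_mul_of_nonneg_right hQS hα.le
      _ = S := by field_simp
  calc (Λ - 1) / Λ * Q ^ 2 = Q * α := by rw [hαdef]; ring
    _ ≤ S := this

/-- **Drive + coercivity**: `(Λ−1)²/(2Λ²)·(Σ zⱼ)² ≤ Σ dⱼ`.
[cite: Tao2016AveragedNS, §1.2, §4 (4.8); elementary] -/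
theorem sq_growth_at_instant (hΛ : 1 < Λ) (hz : ∀ j, |z j| ≤ B * Λ⁻¹ ^ j) (hd : Summable d)
    (h0 : -(z 0 * z 1) ≤ d 0)
    (hS : ∀ j, Λ ^ j * z j ^ 2 - Λ ^ (j + 1) * z (j + 1) * z (j + 2) ≤ d (j + 1)) :
    (Λ - 1) ^ 2 / (2 * Λ ^ 2) * (∑' j, z j) ^ 2 ≤ ∑' j, d j := by
  have hΛ0 : 0 < Λ := by linarith
  have hΛ1 : 0 < Λ - 1 := by linarith
  have hdrive := drive_lower_bound hΛ hz hd h0 hS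
  have hcoer := coercive_lower_bound hΛ hz
  have hsz := summable_of_envelope hΛ hz
  have hsa := summable_abs_of_envelope hΛ hz
  have habs : |∑' j, z j| ≤ ∑' j, |z j| := by
    refine abs_le.2 ⟨?_, hsz.tsum_le_tsum (fun j => le_abs_self _) hsa⟩
    have h : ∑' j, -z j ≤ ∑' j, |z j| := hsz.neg.tsum_le_tsum (fun j => neg_le_abs _) hsa
    rw [tsum_neg] at h
    linarith
  set P : ℝ := ∑' j, z j with hPdef
  set Q : ℝ := ∑' j, |z j| with hQdef
  set S : ℝ := ∑' j, Λ ^ j * z j ^ 2 with hSdef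
  set D : ℝ := ∑' j, d j with hDdef
  have hP : P ^ 2 ≤ Q ^ 2 := by
    rw [← sq_abs P]
    exact pow_le_pow_left₀ (abs_nonneg _) habs 2
  have hc : 0 ≤ (Λ - 1) / (2 * Λ) := by positivity
  have hc' : 0 ≤ (Λ - 1) / Λ := by positivity
  have hid : (Λ - 1) ^ 2 / (2 * Λ ^ 2) = (Λ - 1) / (2 * Λ) * ((Λ - 1) / Λ) := by
    field_simp
  rw [hid]
  calc (Λ - 1) / (2 * Λ) * ((Λ - 1) / Λ) * P ^ 2
      = (Λ - 1) / (2 * Λ) * ((Λ - 1) / Λ * P ^ 2) := by ring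
    _ ≤ (Λ - 1) / (2 * Λ) * ((Λ - 1) / Λ * Q ^ 2) :=
        mul_le_mul_of_nonneg_left (mul_le_mul_of_nonneg_left hP hc') hc
    _ ≤ (Λ - 1) / (2 * Λ) * S := mul_le_mul_of_nonneg_left hcoer hc
    _ ≤ D := hdrive

end Instant

/-! ## The Riccati comparison -/

/-- **Comparison for `f' ≥ k f²`.**  If `f` is differentiable on `[t₀, T)` with `f' ≥ k f²` there
(`k > 0`) and `f(t₀) > 0`, then `(T − t₀)·f(t₀) ≤ k⁻¹`: the solution leaves every bounded set by time
`t₀ + 1/(k f(t₀))`. [folklore] -/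
theorem time_le_of_sq_growth {f f' : ℝ → ℝ} {k t₀ T : ℝ} (hk : 0 < k) (ht : t₀ < T)
    (hf : ∀ t ∈ Ico t₀ T, HasDerivAt f (f' t) t) (hgrow : ∀ t ∈ Ico t₀ T, k * f t ^ 2 ≤ f' t)
    (h0 : 0 < f t₀) : (T - t₀) * f t₀ ≤ k⁻¹ := by
  have hcont : ContinuousOn f (Ico t₀ T) := fun t ht => (hf t ht).continuousAt.continuousWithinAt
  have hint : interior (Ico t₀ T) = Ioo t₀ T := interior_Ico
  -- `f` is monotone on `[t₀, T)`, hence positive there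
  have hmono : MonotoneOn f (Ico t₀ T) := by
    refine monotoneOn_of_hasDerivWithinAt_nonneg (f' := f') (convex_Ico t₀ T) hcont ?_ ?_
    · intro t ht'
      rw [hint] at ht'
      exact (hf t (Ioo_subset_Ico_self ht')).hasDerivWithinAt
    · intro t ht'
      rw [hint] at ht'
      have := hgrow t (Ioo_subset_Ico_self ht')
      nlinarith [sq_nonneg (f t)]
  have hpos : ∀ t ∈ Ico t₀ T, 0 < f t := fun t ht' =>
    h0.trans_le (hmono (left_mem_Ico.2 ht) ht' ht'.1)
  -- `g = −1/f − k·t` is monotone on `[t₀, T)`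
  set g : ℝ → ℝ := fun t => -(f t)⁻¹ - k * t with hgdef
  have hg : ∀ t ∈ Ico t₀ T, HasDerivAt g (f' t / f t ^ 2 - k) t := by
    intro t ht'
    have hne : f t ≠ 0 := (hpos t ht').ne'
    have h1 : HasDerivAt (fun s => (f s)⁻¹) (-(f' t) / f t ^ 2) t := (hf t ht').inv hne
    have h2 : HasDerivAt (fun s => k * s) k t := by
      simpa using (hasDerivAt_id t).const_mul k
    have h3 := h1.neg.sub h2
    refine h3.congr_deriv ?_
    ring
  have hgcont : ContinuousOn g (Ico t₀ T) := fun t ht' => (hg t ht').continuousAt.continuousWithinAt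
  have hgmono : MonotoneOn g (Ico t₀ T) := by
    refine monotoneOn_of_hasDerivWithinAt_nonneg (f' := fun t => f' t / f t ^ 2 - k)
      (convex_Ico t₀ T) hgcont ?_ ?_
    · intro t ht'
      rw [hint] at ht'
      exact (hg t (Ioo_subset_Ico_self ht')).hasDerivWithinAt
    · intro t ht'
      rw [hint] at ht'
      have hIco := Ioo_subset_Ico_self ht'
      have hp := hpos t hIco
      have hgr := hgrow t hIco
      have : k ≤ f' t / f t ^ 2 := by
        rw [le_div_iff₀ (by positivity)]
        exact hgr
      linarith
  -- consequence: `k (t − t₀) < 1/f(t₀)` for every `t ∈ [t₀, T)`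
  have hstep : ∀ t ∈ Ico t₀ T, k * (t - t₀) < (f t₀)⁻¹ := by
    intro t ht'
    have h := hgmono (left_mem_Ico.2 ht) ht' ht'.1
    simp only [hgdef] at h
    have hinv : 0 < (f t)⁻¹ := inv_pos.2 (hpos t ht')
    linarith
  -- hence `k (T − t₀) ≤ 1/f(t₀)`
  by_contra hcon
  push Not at hcon
  have hkf : 0 < k * f t₀ := mul_pos hk h0
  -- the instant `t₁ = t₀ + 1/(k f(t₀))` lies in `[t₀, T)`
  set t₁ : ℝ := t₀ + (k * f t₀)⁻¹ with ht₁
  have ht₁0 : t₀ ≤ t₁ := by rw [ht₁]; linarith [inv_pos.2 hkf]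
  have ht₁T : t₁ < T := by
    rw [ht₁]
    have : (k * f t₀)⁻¹ < T - t₀ := by
      rw [mul_inv, ← div_eq_mul_inv, div_lt_iff₀ h0]
      exact hcon
    linarith
  have h := hstep t₁ ⟨ht₁0, ht₁T⟩
  have hval : k * (t₁ - t₀) = (f t₀)⁻¹ := by
    rw [ht₁]; field_simp; ring
  rw [hval] at h
  exact lt_irrefl _ h

end WakeRatchetDyadicTypeI

end Summit.NavierStokesRegularity.NavierStokesRegularity.Theorems

end
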